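import Summits.QuantumFields.BalabanUV.T4Continuum.Support.NE7Reg10ImpliesReg9
import HarnessLib

/-!
# NE7CubeRegimeScaled — the real arithmetic of gen 112's BOX ROUTE at physical cube size `ℓ` (companion of `NE7AllMinimisersCubeReg910Scaled`): the regime of gen 93's one-scale Uhlenbeck chart
# at radius `R` with `2R+3 ≤ 45ℓM` under `10¹⁶·c·ℓ²·ε ≤ 1`, and the raw bounds of G3a `NE7CubeLandauReg910` at `R₀ = 16ℓM` read as `O(ε∕M²)`, `O(ε∕M³)` with constants linear in `ℓ`

Cell `pub-balaban`, rung (B)+1 sub-cell t4, lineage `b2b-balaban-t4-ne7-p1` (CRUX PROVER NE7 #1 = OWNER of BINDER row NE7), generation 112 (filed gen 113).  Memo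
`t4/b2b-balaban-t4-ne7-p1-g112/ROAD-G112.md` §6(c).  The `ℓ = 1` versions are `NE7AllMinimisersCubeReg910.regime_chart ∕ raw_bounds`.
WHAT ([folklore] real arithmetic; 0 def, 0 sorry).  `regime_chart_scaled` (`η + 8b₀(e^{4b₀} − 1) ≤ 2η`, `576(64·4³X)²(2η) ≤ 1`, `cn(1 + 8X)(256·4³X·2η) ≤ 1∕2`, `128·4³X·2η ≤ 737280ℓε∕M`
for `X, X₂ ≤ 45ℓM`, `η = ε∕M²`), `raw_bounds_scaled` (`j_ε ≤ (C_J+1)ε∕M³`, `G₁ ≤ (6635520 + 64ℓ(C_J+1))ε∕M²`, `Λ ≤ (C_J+2)ε∕M³`, `144·4·a₀·16ℓM ≤ 1`, `a₀ ≤ 1∕4` for `a₀ ≤ 737280ℓε∕M`).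
HONEST FRAMING (page 1): arithmetic only; nothing of Bałaban's asserted; nothing about minimisers; NOT NE3∕NE7 as spine nodes; spine 0∕9; finite T⁴ rung (B)+1 — NOT infinite volume, NOT mass gap,
NOT BetaPertH, NOT Clay.
-/

set_option autoImplicit false

open scoped BigOperators

namespace Summit.QuantumFields.BalabanUV.T4Continuum.NE7CubeRegimeScaled

noncomputable section

/-! ## Real arithmetic at size `ℓ` -/

section Arith

/-- `e^{t} − 1 ≤ 2t` for `0 ≤ t ≤ 1`. [folklore] -/
private theorem exp_sub_one_le' (t : ℝ) (h0 : 0 ≤ t) (h1 : t ≤ 1) : Real.exp t - 1 ≤ 2 * t := by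
  have h' := Real.abs_exp_sub_one_le (x := t) (by rw [abs_of_nonneg h0]; exact h1)
  rw [abs_of_nonneg h0] at h'
  exact (le_abs_self _).trans h'

/-- **THE CHART REGIME AT PHYSICAL SIZE `ℓ`**: `X = 2R+3 ≤ 45ℓM`, `X₂ = 2R+2 ≤ 45ℓM`, `η = ε∕M²`, `ε′ = 2η`, under `10¹⁶·c·ℓ²·ε ≤ 1`: the three hypotheses of
`cube_landau_chart` and the sup currency `128·4³·X·ε′ ≤ 737280·ℓ·ε∕M`. [folklore] -/
theorem regime_chart_scaled {M ε c cn X X₂ ℓ : ℝ} (hM : 1 ≤ M) (hε : 0 < ε) (hc : 1 ≤ c) (hcn1 : 1 ≤ cn) (hcnc : cn ≤ c) (hℓ : 1 ≤ ℓ)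
    (hsmall : 10 ^ 16 * c * ℓ ^ 2 * ε ≤ 1) (hX : X ≤ 45 * ℓ * M) (hX1 : 1 ≤ X) (hX₂ : X₂ ≤ 45 * ℓ * M) (hX₂0 : 0 ≤ X₂) :
    ε / M ^ 2 + 8 * (Real.pi / 2 * (3 * X₂ * (ε / M ^ 2))) * (Real.exp (4 * (Real.pi / 2 * (3 * X₂ * (ε / M ^ 2)))) - 1) ≤ 2 * (ε / M ^ 2) ∧
    576 * (64 * ((4 : ℕ) : ℝ) ^ 3 * X) ^ 2 * (2 * (ε / M ^ 2)) ≤ 1 ∧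
    cn * (1 + 2 * ((4 : ℕ) : ℝ) * X) * (256 * ((4 : ℕ) : ℝ) ^ 3 * X * (2 * (ε / M ^ 2))) ≤ 1 / 2 ∧
    128 * ((4 : ℕ) : ℝ) ^ 3 * X * (2 * (ε / M ^ 2)) ≤ 737280 * ℓ * ε / M := by
  have hM0 : 0 < M := by linarith
  have hM2 : 0 < M ^ 2 := by positivity
  have hℓ2 : 1 ≤ ℓ ^ 2 := one_le_pow₀ hℓ
  have hℓε0 : 0 < ℓ ^ 2 * ε := by positivity
  have hεc : ℓ ^ 2 * ε ≤ 1 / 10 ^ 16 := by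
    rw [le_div_iff₀ (by norm_num : (0:ℝ) < 10 ^ 16)]
    nlinarith
  have hεcn : cn * (ℓ ^ 2 * ε) ≤ 1 / 10 ^ 16 := by
    rw [le_div_iff₀ (by norm_num : (0:ℝ) < 10 ^ 16)]
    nlinarith [mul_le_mul_of_nonneg_right hcnc hℓε0.le]
  have hℓεε : ε ≤ ℓ ^ 2 * ε := le_mul_of_one_le_left hε.le hℓ2
  have hℓε1 : ℓ * ε ≤ ℓ ^ 2 * ε := by nlinarith
  set η : ℝ := ε / M ^ 2 with hηdef
  have hη0 : 0 < η := by positivity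
  have hηε : η ≤ ε := by rw [hηdef]; exact div_le_self hε.le (one_le_pow₀ hM)
  have hℓ0 : 0 < ℓ := by linarith
  have hXη : X * η ≤ 45 * ℓ * ε / M := by
    calc X * η ≤ 45 * ℓ * M * η := mul_le_mul_of_nonneg_right hX hη0.le
      _ = 45 * ℓ * ε / M := by rw [hηdef]; field_simp
  have hX₂η : X₂ * η ≤ 45 * ℓ * ε / M := by
    calc X₂ * η ≤ 45 * ℓ * M * η := mul_le_mul_of_nonneg_right hX₂ hη0.le
      _ = 45 * ℓ * ε / M := by rw [hηdef]; field_simp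
  have hεM : ℓ * ε / M ≤ ℓ * ε := div_le_self (by positivity) hM
  have hX2η : X ^ 2 * η ≤ 2025 * (ℓ ^ 2 * ε) := by
    calc X ^ 2 * η ≤ (45 * ℓ * M) ^ 2 * η := mul_le_mul_of_nonneg_right (pow_le_pow_left₀ (by linarith) hX 2) hη0.le
      _ = 2025 * (ℓ ^ 2 * ε) := by rw [hηdef]; field_simp; ring
  refine ⟨?_, ?_, ?_, ?_⟩
  · -- (c1): `b₀ ≤ 270 ε/M ≤ 270 ε`, `4b₀ ≤ 1`, `8b₀(e^{4b₀}−1) ≤ 64b₀² ≤ η`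
    set b₀ : ℝ := Real.pi / 2 * (3 * X₂ * η) with hb₀
    have hb₀0 : 0 ≤ b₀ := by positivity
    have hpi : Real.pi / 2 ≤ 2 := by linarith [Real.pi_le_four]
    have hb₀le : b₀ ≤ 270 * ℓ * ε / M := by
      calc b₀ ≤ 2 * (3 * X₂ * η) := mul_le_mul_of_nonneg_right hpi (by positivity)
        _ = 6 * (X₂ * η) := by ring
        _ ≤ 6 * (45 * ℓ * ε / M) := by linarith
        _ = 270 * ℓ * ε / M := by ring
    have hb₀le' : b₀ ≤ 270 * (ℓ * ε) := hb₀le.trans (by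
      have := mul_le_mul_of_nonneg_left hεM (by norm_num : (0:ℝ) ≤ 270)
      linarith [show 270 * ℓ * ε / M = 270 * (ℓ * ε / M) by ring])
    have h4b : 4 * b₀ ≤ 1 := by nlinarith
    have hexp : Real.exp (4 * b₀) - 1 ≤ 2 * (4 * b₀) := exp_sub_one_le' _ (by positivity) h4b
    have hsq : 8 * b₀ * (Real.exp (4 * b₀) - 1) ≤ 64 * b₀ ^ 2 := by nlinarith
    have hb₀sq : 64 * b₀ ^ 2 ≤ η := by
      have h1 : b₀ ^ 2 ≤ (270 * ℓ * ε / M) ^ 2 := pow_le_pow_left₀ hb₀0 hb₀le 2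
      have h2 : 64 * (270 * ℓ * ε / M) ^ 2 = (4665600 * (ℓ ^ 2 * ε)) * (ε / M ^ 2) := by field_simp; ring
      have h3 : (4665600 * (ℓ ^ 2 * ε)) * (ε / M ^ 2) ≤ 1 * (ε / M ^ 2) := mul_le_mul_of_nonneg_right (by nlinarith) hη0.le
      rw [hηdef]; linarith
    linarith
  · -- (c2)
    push_cast
    have : 576 * (64 * (4 : ℝ) ^ 3 * X) ^ 2 * (2 * η) = 19327352832 * (X ^ 2 * η) := by ring
    rw [this]; nlinarith
  · -- (c3)
    push_cast
    have h1 : (1 + 2 * (4 : ℝ) * X) ≤ 9 * X := by linarith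
    have h2 : cn * (1 + 2 * (4 : ℝ) * X) * (256 * (4 : ℝ) ^ 3 * X * (2 * η)) ≤ cn * (9 * X) * (256 * (4 : ℝ) ^ 3 * X * (2 * η)) :=
      mul_le_mul_of_nonneg_right (mul_le_mul_of_nonneg_left h1 (by linarith)) (by positivity)
    have h3 : cn * (9 * X) * (256 * (4 : ℝ) ^ 3 * X * (2 * η)) = 294912 * cn * (X ^ 2 * η) := by ring
    rw [h3] at h2
    have h4 : 294912 * cn * (X ^ 2 * η) ≤ 294912 * cn * (2025 * (ℓ ^ 2 * ε)) := mul_le_mul_of_nonneg_left hX2η (by positivity)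
    nlinarith
  · -- (c4)
    push_cast
    calc 128 * (4 : ℝ) ^ 3 * X * (2 * η) = 16384 * (X * η) := by ring
      _ ≤ 16384 * (45 * ℓ * ε / M) := by linarith
      _ = 737280 * ℓ * ε / M := by ring
set_option maxHeartbeats 400000 in
/-- **THE RAW BOUNDS OF G3a ARE `O(ε∕M²)`, `O(ε∕M³)`.**  With `η = ε∕M²`, `a₀ ≤ 737280ε∕M` (`0 ≤ a₀`), `j = C_J ε∕M³`, under `10¹⁶·c·ε ≤ 1` with `C_J + 1 ≤ c`:
`j_ε ≤ (C_J + 1)ε∕M³`, `G₁ ≤ K₂ε∕M²` (`K₂ = 6635520 + 64(C_J + 1)`), `Λ ≤ (C_J + 2)ε∕M³`, `144·4·a₀·(16M) ≤ 1`, `a₀ ≤ 1∕4`. [folklore] -/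
theorem raw_bounds_scaled {M ε c CJ a₀ ℓ : ℝ} (hM : 1 ≤ M) (hε : 0 < ε) (hc : 1 ≤ c) (hCJ : 0 ≤ CJ) (hCJc : CJ + 1 ≤ c) (hℓ : 1 ≤ ℓ)
    (hsmall : 10 ^ 16 * c * ℓ ^ 2 * ε ≤ 1) (ha₀0 : 0 ≤ a₀) (ha₀ : a₀ ≤ 737280 * ℓ * ε / M) :
    let η : ℝ := ε / M ^ 2
    let jε : ℝ := CJ * ε / M ^ 3 + 4 * (η * (Real.exp a₀ - 1) * (2 + (Real.exp a₀ - 1)) + 2 * η * η * (2 + η))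
    let G₁ : ℝ := 36 * 4 * a₀ / (16 * (ℓ * M)) + 4 * (16 * (ℓ * M)) * jε
    jε ≤ (CJ + 1) * ε / M ^ 3 ∧ G₁ ≤ (6635520 + 64 * ℓ * (CJ + 1)) * ε / M ^ 2 ∧
    jε + (4 * 4 * (Real.exp (4 * a₀) - 1) + 2 * 4 * (Real.exp a₀ - 1)) * G₁ ≤ (CJ + 2) * ε / M ^ 3 ∧
    144 * 4 * a₀ * (16 * (ℓ * M)) ≤ 1 ∧ a₀ ≤ 1 / 4 := by
  intro η jε G₁
  have hM0 : 0 < M := by linarith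
  have hM3 : 0 < M ^ 3 := by positivity
  have hℓ0 : 0 < ℓ := by linarith
  have hℓ2 : 1 ≤ ℓ ^ 2 := one_le_pow₀ hℓ
  have hℓε0 : 0 < ℓ ^ 2 * ε := by positivity
  have hεsmall' : 10 ^ 16 * (ℓ ^ 2 * ε) ≤ 1 := by nlinarith
  have hℓεε : ε ≤ ℓ ^ 2 * ε := le_mul_of_one_le_left hε.le hℓ2
  have hℓε1 : ℓ * ε ≤ ℓ ^ 2 * ε := by nlinarith
  have hεsmall : 10 ^ 16 * ε ≤ 1 := by nlinarith
  have hεℓ : 10 ^ 16 * (ℓ * ε) ≤ 1 := by nlinarith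
  have hεCJ : 10 ^ 16 * (CJ + 1) * (ℓ ^ 2 * ε) ≤ 1 := by nlinarith [mul_le_mul_of_nonneg_right hCJc hℓε0.le]
  have ha₀ε : a₀ ≤ 737280 * (ℓ * ε) := ha₀.trans (by
    have : 737280 * ℓ * ε / M ≤ 737280 * ℓ * ε / 1 := div_le_div_of_nonneg_left (by positivity) one_pos hM
    rw [div_one] at this; linarith)
  have ha₀1 : a₀ ≤ 1 := by nlinarith
  have ha₀4 : a₀ ≤ 1 / 4 := by nlinarith
  have he1 : Real.exp a₀ - 1 ≤ 2 * a₀ := exp_sub_one_le' a₀ ha₀0 ha₀1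
  have he4 : Real.exp (4 * a₀) - 1 ≤ 2 * (4 * a₀) := exp_sub_one_le' _ (by positivity) (by linarith)
  have hb0 : 0 ≤ Real.exp a₀ - 1 := by linarith [Real.add_one_le_exp a₀]
  have hb4 : 0 ≤ Real.exp (4 * a₀) - 1 := by linarith [Real.add_one_le_exp (4 * a₀)]
  have hη0 : 0 < η := by positivity
  have hη1 : η ≤ 1 := by
    have : η ≤ ε := div_le_self hε.le (one_le_pow₀ hM)
    nlinarith
  -- `jε ≤ (C_J+1)ε/M³`
  have hjε : jε ≤ (CJ + 1) * ε / M ^ 3 := by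
    have t1 : η * (Real.exp a₀ - 1) * (2 + (Real.exp a₀ - 1)) ≤ η * (2 * a₀) * 3 := by
      have : 2 + (Real.exp a₀ - 1) ≤ 3 := by linarith
      calc η * (Real.exp a₀ - 1) * (2 + (Real.exp a₀ - 1)) ≤ η * (2 * a₀) * (2 + (Real.exp a₀ - 1)) :=
            mul_le_mul_of_nonneg_right (mul_le_mul_of_nonneg_left he1 hη0.le) (by linarith)
        _ ≤ η * (2 * a₀) * 3 := mul_le_mul_of_nonneg_left this (by positivity)
    have t2 : 2 * η * η * (2 + η) ≤ 6 * η * η := by nlinarith [mul_nonneg (mul_nonneg hη0.le hη0.le) (sub_nonneg.2 hη1)]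
    have t3 : η * a₀ ≤ 737280 * (ℓ * ε) * (ε / M ^ 3) := by
      calc η * a₀ ≤ η * (737280 * ℓ * ε / M) := mul_le_mul_of_nonneg_left ha₀ hη0.le
        _ = 737280 * (ℓ * ε) * (ε / M ^ 3) := by show ε / M ^ 2 * (737280 * ℓ * ε / M) = _; field_simp
    have t4 : η * η ≤ ε * (ε / M ^ 3) := by
      have : η * η = ε * (ε / M ^ 4) := by show ε / M ^ 2 * (ε / M ^ 2) = _; field_simp
      rw [this]
      refine mul_le_mul_of_nonneg_left ?_ hε.le
      exact div_le_div_of_nonneg_left hε.le hM3 (pow_le_pow_right₀ hM (by norm_num))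
    have t5 : 4 * (η * (Real.exp a₀ - 1) * (2 + (Real.exp a₀ - 1)) + 2 * η * η * (2 + η)) ≤ (17694720 * (ℓ * ε) + 24 * ε) * (ε / M ^ 3) := by
      nlinarith
    have t6 : (17694720 * (ℓ * ε) + 24 * ε) * (ε / M ^ 3) ≤ 1 * (ε / M ^ 3) := mul_le_mul_of_nonneg_right (by nlinarith) (by positivity)
    have e : (CJ + 1) * ε / M ^ 3 = CJ * ε / M ^ 3 + 1 * (ε / M ^ 3) := by ring
    show CJ * ε / M ^ 3 + 4 * (η * (Real.exp a₀ - 1) * (2 + (Real.exp a₀ - 1)) + 2 * η * η * (2 + η)) ≤ (CJ + 1) * ε / M ^ 3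
    rw [e]; linarith
  have hjε0 : 0 ≤ jε := by
    show 0 ≤ CJ * ε / M ^ 3 + 4 * (η * (Real.exp a₀ - 1) * (2 + (Real.exp a₀ - 1)) + 2 * η * η * (2 + η))
    positivity
  -- `G₁ ≤ K₂ ε/M²`
  have hG₁ : G₁ ≤ (6635520 + 64 * ℓ * (CJ + 1)) * ε / M ^ 2 := by
    have t1 : 36 * 4 * a₀ / (16 * (ℓ * M)) = 9 * (a₀ / (ℓ * M)) := by field_simp; ring
    have t2 : a₀ / (ℓ * M) ≤ 737280 * ε / M ^ 2 := by
      rw [div_le_iff₀ (by positivity)]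
      calc a₀ ≤ 737280 * ℓ * ε / M := ha₀
        _ = 737280 * ε / M ^ 2 * (ℓ * M) := by field_simp
    have t3 : 4 * (16 * (ℓ * M)) * jε ≤ 4 * (16 * (ℓ * M)) * ((CJ + 1) * ε / M ^ 3) := mul_le_mul_of_nonneg_left hjε (by positivity)
    have t4 : 4 * (16 * (ℓ * M)) * ((CJ + 1) * ε / M ^ 3) = 64 * ℓ * (CJ + 1) * ε / M ^ 2 := by field_simp; ring
    have e : (6635520 + 64 * ℓ * (CJ + 1)) * ε / M ^ 2 = 9 * (737280 * ε / M ^ 2) + 64 * ℓ * (CJ + 1) * ε / M ^ 2 := by ring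
    show 36 * 4 * a₀ / (16 * (ℓ * M)) + 4 * (16 * (ℓ * M)) * jε ≤ (6635520 + 64 * ℓ * (CJ + 1)) * ε / M ^ 2
    rw [t1, e]; linarith
  have hG₁0 : 0 ≤ G₁ := by show 0 ≤ 36 * 4 * a₀ / (16 * (ℓ * M)) + 4 * (16 * (ℓ * M)) * jε; positivity
  -- `Λ ≤ (C_J+2)ε/M³`
  have hθ : 4 * 4 * (Real.exp (4 * a₀) - 1) + 2 * 4 * (Real.exp a₀ - 1) ≤ 144 * a₀ := by nlinarith
  have hK : (106168320 * ℓ * (6635520 + 64 * ℓ * (CJ + 1)) * ε) ≤ 1 := by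
    have e1 : 106168320 * ℓ * (6635520 + 64 * ℓ * (CJ + 1)) * ε = 704482010726400 * (ℓ * ε) + 6794772480 * ((CJ + 1) * (ℓ ^ 2 * ε)) := by ring
    rw [e1]; nlinarith [mul_le_mul_of_nonneg_right hCJc hℓε0.le]
  have hΛ : jε + (4 * 4 * (Real.exp (4 * a₀) - 1) + 2 * 4 * (Real.exp a₀ - 1)) * G₁ ≤ (CJ + 2) * ε / M ^ 3 := by
    have t1 : (4 * 4 * (Real.exp (4 * a₀) - 1) + 2 * 4 * (Real.exp a₀ - 1)) * G₁ ≤ 144 * a₀ * G₁ := mul_le_mul_of_nonneg_right hθ hG₁0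
    have t2 : 144 * a₀ * G₁ ≤ 144 * (737280 * ℓ * ε / M) * ((6635520 + 64 * ℓ * (CJ + 1)) * ε / M ^ 2) :=
      mul_le_mul (mul_le_mul_of_nonneg_left ha₀ (by norm_num)) hG₁ hG₁0 (by positivity)
    have t3 : 144 * (737280 * ℓ * ε / M) * ((6635520 + 64 * ℓ * (CJ + 1)) * ε / M ^ 2) = (106168320 * ℓ * (6635520 + 64 * ℓ * (CJ + 1)) * ε) * (ε / M ^ 3) := by
      field_simp; ring
    have t4 : (106168320 * ℓ * (6635520 + 64 * ℓ * (CJ + 1)) * ε) * (ε / M ^ 3) ≤ 1 * (ε / M ^ 3) :=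
      mul_le_mul_of_nonneg_right hK (by positivity)
    have t5 : 144 * a₀ * G₁ ≤ 1 * (ε / M ^ 3) := by rw [t3] at t2; exact t2.trans t4
    have e : (CJ + 2) * ε / M ^ 3 = (CJ + 1) * ε / M ^ 3 + 1 * (ε / M ^ 3) := by ring
    rw [e]; linarith
  have haM : a₀ * M ≤ 737280 * ℓ * ε := (le_div_iff₀ hM0).1 ha₀
  have hreg : 144 * 4 * a₀ * (16 * (ℓ * M)) ≤ 1 := by
    have e0 : 144 * 4 * a₀ * (16 * (ℓ * M)) = 9216 * ℓ * (a₀ * M) := by ring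
    have h1 : 9216 * ℓ * (a₀ * M) ≤ 9216 * ℓ * (737280 * ℓ * ε) := mul_le_mul_of_nonneg_left haM (by positivity)
    have h2 : 9216 * ℓ * (737280 * ℓ * ε) = 6794772480 * (ℓ ^ 2 * ε) := by ring
    rw [e0]; linarith
  exact ⟨hjε, hG₁, hΛ, hreg, ha₀4⟩

end Arith


end

end Summit.QuantumFields.BalabanUV.T4Continuum.NE7CubeRegimeScaled
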